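import Summits.Ventures.HodgeRepro2.T5LocalHermitian

/-!
# T5LocalSelection — the conservation relation, the local selection rule and the global classification
(Tier-5 sub-step N2, support file of seat p3; continues `T5LocalHermitian.lean`)

Cell `pub-hodge-repro2`, README §7 (Tier 5, discharge (N)); support for route-3's `route/T5-route-3.md`
rows A2 (W₃₄ ≅ W₁₂ from Shimura 2008 Theorem 2.2 (i) / Gross 2021 Theorem 3.1) and A6 (the NECESSITY of
W₃₄,v ≅ W₁₂,v at every non-split finite place from Gong–Grenié 2011 Theorem 3.10, the local step of
route-3's Lemma N.1). Prose: `route/T5-SUPPORT-p3.md`. Printed theorems enter as structure fields (Props);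
the arithmetic is kernel-checked; the sign table of row A2 is decided.
-/

namespace Summit.Ventures.HodgeRepro2.T5LocalHermitian

open Matrix

/-! ## §4. The conservation relation and the local selection rule (row A6 / Lemma N.1, local step) -/

/-- Gong–Grenié 2011 p. 175 / Theorem 3.10 (p. 168; residual characteristic ≠ 2) — or Sun–Zhu Theorem 1.10
(every `p`, with equality) — for ONE irreducible admissible `π` of `G(W)`, `dim W = n`, and the two EVEN Witt
towers `V^±_m` (`m₀ = 0`): `occurs ε m` = «θ_χ(π, V^ε_m) ≠ 0», `first ε` = `m^ε_χ(π)` = the smallest such `m`. -/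
structure ConservationData where
  /-- `n = dim W` -/
  n : ℕ
  /-- `occurs ε m` ⟺ `θ_χ(π, V^ε_m) ≠ 0` -/
  occurs : ℤˣ → ℕ → Prop
  /-- `m^ε_χ(π)` -/
  first : ℤˣ → ℕ
  /-- `m^ε_χ(π)` is the SMALLEST `m` with `θ_χ(π, V^ε_m) ≠ 0` (the definition, p. 175 ll. 48–50) -/
  first_le : ∀ ε m, occurs ε m → first ε ≤ m
  /-- Theorem 3.10: `m⁺_χ(π) + m⁻_χ(π) ⩾ 2n + 2` -/
  conservation : 2 * n + 2 ≤ first 1 + first (-1)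

namespace ConservationData

/-- If `π` occurs on `V⁺_m` and on `V⁻_{m′}` then `m + m′ ≥ 2n + 2`. -/
theorem add_ge_of_occurs (D : ConservationData) {m m' : ℕ} (h : D.occurs 1 m) (h' : D.occurs (-1) m') :
    2 * D.n + 2 ≤ m + m' := by
  have h1 := D.first_le 1 m h
  have h2 := D.first_le (-1) m' h'
  have h3 := D.conservation
  omega

/-- For `n ≥ 3` (our `n = 3`: `π = σ̄_v` on `U(V_v)`, `dim V = 3`) `π` cannot occur on BOTH two-dimensional
spaces `V⁺₂ = ℍ` and `V⁻₂` (the anisotropic plane): `2 + 2 = 4 < 8 ≤ m⁺ + m⁻`. -/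
theorem not_occurs_two_both (D : ConservationData) (hn : 3 ≤ D.n) :
    ¬ (D.occurs 1 2 ∧ D.occurs (-1) 2) := by
  rintro ⟨h, h'⟩
  have := D.add_ge_of_occurs h h'
  omega

end ConservationData

/-- The local selection rule at a non-split finite place (T5-route-3 row A6, local step of Lemma N.1):
the local model, the conservation data of `σ̄_v`, the two two-dimensional spaces `W₁₂,v`, `W₃₄,v`, and the
link «the local theta lift of `σ̄_v` to `U(x)` is non-zero ⟹ `σ̄_v` occurs on the tower member of sign
`ε(x)` and dimension `dim x`» (the identification of `x` with `V^{ε(x)}_{dim x}` — Lemma 1.6). -/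
structure SelectionData (X : Type*) where
  /-- the printed local classification -/
  M : LocalModel X
  /-- Gong–Grenié / Sun–Zhu data of `π = σ̄_v` -/
  D : ConservationData
  /-- `dim V_v = 3` -/
  n_eq : D.n = 3
  /-- `W₁₂,v` -/
  W12 : X
  /-- `W₃₄,v` -/
  W34 : X
  dim_W12 : M.dim W12 = 2
  dim_W34 : M.dim W34 = 2
  /-- «the local theta lift of `σ̄_v` to `U(x)` is non-zero» -/
  liftNonzero : X → Prop
  /-- non-zero lift to `U(x)` ⟹ occurrence on `V^{ε(x)}_{dim x}` -/
  occurs_of_liftNonzero : ∀ x, liftNonzero x → D.occurs (M.towerSign x) (M.dim x)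

namespace SelectionData

variable {X : Type*} (S : SelectionData X)

/-- LOCAL SELECTION (row A6): if `σ̄_v` lifts non-trivially to both `U(W₁₂,v)` and `U(W₃₄,v)`, then
`W₁₂,v ≅ W₃₄,v`. Proof: equal tower signs give isometry by Lemma 1.6 (both of dimension 2); distinct tower
signs would make `σ̄_v` occur on both `V⁺₂` and `V⁻₂`, against `m⁺ + m⁻ ≥ 8`. -/
theorem isom_of_liftNonzero_both (h12 : S.liftNonzero S.W12) (h34 : S.liftNonzero S.W34) :
    S.M.Isom S.W12 S.W34 := by
  rw [S.M.isom_iff, S.dim_W12, S.dim_W34]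
  refine ⟨rfl, ?_⟩
  by_contra hne
  have o12 := S.occurs_of_liftNonzero _ h12
  have o34 := S.occurs_of_liftNonzero _ h34
  rw [S.dim_W12] at o12
  rw [S.dim_W34] at o34
  have hn : 3 ≤ S.D.n := by rw [S.n_eq]
  rcases S.M.towerSign_cases _ _ hne with ⟨h1, h2⟩ | ⟨h1, h2⟩
  · rw [h1] at o12
    rw [h2] at o34
    exact S.D.not_occurs_two_both hn ⟨o12, o34⟩
  · rw [h1] at o12
    rw [h2] at o34
    exact S.D.not_occurs_two_both hn ⟨o34, o12⟩

/-- The same conclusion in determinant-class form: `χ_v(det W₁₂,v) = χ_v(det W₃₄,v)`. -/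
theorem det_eq_of_liftNonzero_both (h12 : S.liftNonzero S.W12) (h34 : S.liftNonzero S.W34) :
    S.M.det S.W12 = S.M.det S.W34 :=
  (S.M.isom_iff_of_dim_two _ _ S.dim_W12 S.dim_W34).mp (S.isom_of_liftNonzero_both h12 h34)

end SelectionData

/-! ## §5. The global classification (Landherr) as a model, and row A2 -/

/-- Shimura 2008, Theorem 2.2 (i) (p. 748) = Landherr 1936 (also Gross 2021 Thm 3.1 + the local invariants):
«The isomorphism class of (V, ϕ) is determined by n, {σ_v}, and d₀(ϕ)», with `σ_v = s_v(ϕ) = p_v − q_v` at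
the real places `v ∈ r₀` of `F⁺` not split in `F` (ALL real places, `F` a CM field) and `d₀(ϕ)` the GLOBAL
class in `F^{+×}/N(F^×)` (modelled by a commutative group `G`). -/
structure GlobalModel (Y : Type*) (G : Type*) [CommGroup G] (R : Type*) where
  /-- `dim` -/
  dim : Y → ℕ
  /-- `d₀(ϕ) ∈ F^{+×}/N(F^×)` -/
  d0 : Y → G
  /-- `s_v(ϕ) = p_v − q_v` at `v ∈ r₀` -/
  index : Y → R → ℤ
  /-- isometry over `F⁺` -/
  Isom : Y → Y → Prop
  /-- Theorem 2.2 (i) -/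
  thm22 : ∀ x y, dim x = dim y → d0 x = d0 y → (∀ v, index x v = index y v) → Isom x y

namespace GlobalModel

variable {Y G R : Type*} [CommGroup G] (M : GlobalModel Y G R)

/-- Row A2: equal dimension, the SAME global `d₀` (T5-route-3 row A2: `e₁₀₁e₁₁₀ = e₁₁₁e₁₀₀` exactly —
`det_diagonal_two_scale`) and the same indices at the three real places ⟹ `W₃₄ ≅ W₁₂`. -/
theorem isom_of_invariants (x y : Y) (hdim : M.dim x = M.dim y) (hd : M.d0 x = M.d0 y)
    (hs : ∀ v, M.index x v = M.index y v) : M.Isom x y :=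
  M.thm22 x y hdim hd hs

end GlobalModel

/-- The index `s = p − q` of a real place from the signs of the two diagonal entries of `⟨a⟩ ⊕ ⟨b⟩`
(Shimura §2.1: `ϕ_v ≅ diag[1_p, −1_q]`, `s_v = p − q`): `+1` for each positive entry, `−1` for each negative. -/
def indexOfSigns (a b : Bool) : ℤ := (if a then 1 else -1) + (if b then 1 else -1)

/-- The sign table of T5-route-3 row A1/A2 at `(ι₁, ι₂, ι₃)` — `true` = positive entry of the hermitian
form `δ⁻¹·e` (= `Im ι(e) > 0` with `Im ι(δ) > 0`): `e₁₁₁ = (−,−,−)`, `e₁₀₀ = (−,+,+)`,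
`e₁₀₁ = u·e₁₁₁ = (−,+,−)`, `e₁₁₀ = u⁻¹·e₁₀₀ = (−,−,+)` for `u = (+,−,+)`. -/
def signs111 : Fin 3 → Bool := ![false, false, false]
/-- see `signs111` -/
def signs100 : Fin 3 → Bool := ![false, true, true]
/-- `u = (+,−,+)` -/
def signsU : Fin 3 → Bool := ![true, false, true]
/-- the sign of a product is the XNOR of the signs -/
def mulSign (a b : Bool) : Bool := (a == b)
/-- `e₁₀₁ = u·e₁₁₁` -/
def signs101 : Fin 3 → Bool := fun i => mulSign (signsU i) (signs111 i)
/-- `e₁₁₀ = u⁻¹·e₁₀₀` (the sign of `u⁻¹` is the sign of `u`) -/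
def signs110 : Fin 3 → Bool := fun i => mulSign (signsU i) (signs100 i)

/-- Kernel check of row A2's «signatures (0,2), (1,1), (1,1) at ι₁, ι₂, ι₃ for both»: the indices
`s_v(W₁₂) = s_v(⟨e₁₁₁⟩ ⊕ ⟨e₁₀₀⟩)` and `s_v(W₃₄) = s_v(⟨e₁₀₁⟩ ⊕ ⟨e₁₁₀⟩)` agree at each of the three real
places, and equal `(−2, 0, 0)`. -/
theorem index_W12_eq_W34 :
    (∀ v : Fin 3, indexOfSigns (signs111 v) (signs100 v) = indexOfSigns (signs101 v) (signs110 v)) ∧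
    (![indexOfSigns (signs111 0) (signs100 0), indexOfSigns (signs111 1) (signs100 1),
        indexOfSigns (signs111 2) (signs100 2)] = ![-2, 0, 0]) := by
  constructor
  · decide
  · decide


/-! ## §6. Lemma N.1 assembled — the local selection at every place and the Hasse principle -/

/-- The NECESSITY direction of route-3's Lemma N.1 as a skeleton over the places of `F⁺`: `LocIsom v` =
«`W₁₂,v ≅ W₃₄,v`», the four types of places, the local inputs at each type (the printed ones as fields
whose discharge is named in the docstring), the residual [G-N2.1] ISOLATED as the field `dyadic`, and the
Hasse principle. -/
structure NecessityAssembly (Place : Type*) where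
  /-- `W₁₂,v ≅ W₃₄,v` -/
  LocIsom : Place → Prop
  /-- finite, non-split in `F`, `v ∤ 2` (Gong–Grenié's standing hypothesis) -/
  isNonSplitOdd : Place → Prop
  /-- finite, non-split in `F`, `v ∣ 2` -/
  isNonSplitDyadic : Place → Prop
  /-- finite, split in `F` -/
  isSplit : Place → Prop
  /-- real (all three real places of `F⁺` ramify in the CM field `F`) -/
  isReal : Place → Prop
  /-- every place is of one of the four types -/
  cover : ∀ v, isNonSplitOdd v ∨ isNonSplitDyadic v ∨ isSplit v ∨ isReal v
  /-- «the local theta lift of `σ̄_v` to `U(W₁₂,v)` is non-zero» -/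
  liftNonzero12 : Place → Prop
  /-- «the local theta lift of `σ̄_v` to `U(W₃₄,v)` is non-zero» -/
  liftNonzero34 : Place → Prop
  /-- non-split `v ∤ 2`: discharged by `SelectionData.isom_of_liftNonzero_both` (Gong–Grenié Thm 3.10 +
  Shimura Lemma 1.6) -/
  selection : ∀ v, isNonSplitOdd v → liftNonzero12 v → liftNonzero34 v → LocIsom v
  /-- non-split `v ∣ 2`: the SAME statement is the residual [G-N2.1] (Sun–Zhu Thm 1.10, arXiv layer only;
  HKS96 Cor. 4.4 when `σ̄_v` is supercuspidal) — a HYPOTHESIS here, not discharged -/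
  dyadic : ∀ v, isNonSplitDyadic v → liftNonzero12 v → liftNonzero34 v → LocIsom v
  /-- split `v`: one class per dimension (Shimura 2008 p. 743 / §1.8; Gross 2021 §3) -/
  split : ∀ v, isSplit v → LocIsom v
  /-- real `v`: both signatures are `(0,2), (1,1), (1,1)` (`index_W12_eq_W34`) -/
  real : ∀ v, isReal v → LocIsom v
  /-- `W₁₂ ≅ W₃₄` over `F⁺` -/
  Isom : Prop
  /-- the Hasse principle (Gross 2021 Thm 3.1 uniqueness; Shimura 2008 Thm 2.2 (i) «in view of the Hasse
  principle») -/
  hasse : (∀ v, LocIsom v) → Isom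

namespace NecessityAssembly

variable {Place : Type*} (A : NecessityAssembly Place)

/-- If both local lifts are non-zero at every place then `W₁₂,v ≅ W₃₄,v` at every place. -/
theorem locIsom_of_liftNonzero (h12 : ∀ v, A.liftNonzero12 v) (h34 : ∀ v, A.liftNonzero34 v) (v : Place) :
    A.LocIsom v := by
  rcases A.cover v with h | h | h | h
  · exact A.selection v h (h12 v) (h34 v)
  · exact A.dyadic v h (h12 v) (h34 v)
  · exact A.split v h
  · exact A.real v h

/-- Lemma N.1, necessity: both local lifts non-zero everywhere (the consequence of (N) for both pairs, route-3
N2.2.1) ⟹ `W₁₂ ≅ W₃₄`. The residual [G-N2.1] is exactly the field `dyadic`; when no place is non-split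
dyadic (e.g. 2 split in the imaginary quadratic subfield, route-3 N2.2.5) that field is vacuous. -/
theorem isom_of_liftNonzero (h12 : ∀ v, A.liftNonzero12 v) (h34 : ∀ v, A.liftNonzero34 v) : A.Isom :=
  A.hasse (A.locIsom_of_liftNonzero h12 h34)

/-- The dyadic field is vacuous when there is no non-split dyadic place: then `dyadic` can be supplied
trivially, and the assembly rests on printed inputs only. -/
theorem dyadic_vacuous (isNonSplitDyadic : Place → Prop) (hno : ∀ v, ¬ isNonSplitDyadic v)
    (LocIsom liftNonzero12 liftNonzero34 : Place → Prop) :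
    ∀ v, isNonSplitDyadic v → liftNonzero12 v → liftNonzero34 v → LocIsom v :=
  fun v h => absurd h (hno v)

/-- A `SelectionData` at a place discharges the `selection` field's conclusion there. -/
theorem selection_of_selectionData {X : Type*} (S : SelectionData X) (h12 : S.liftNonzero S.W12)
    (h34 : S.liftNonzero S.W34) : S.M.Isom S.W12 S.W34 :=
  S.isom_of_liftNonzero_both h12 h34

end NecessityAssembly

end Summit.Ventures.HodgeRepro2.T5LocalHermitian
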